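import Summits.KontsevichZagierPeriods.KontsevichZagierPeriods.Theorems.LinRedNormalFormArrangementNormalFormStubRebaseSimplePosCells

/-!
# Stub `stub_rebaseSimplePos` (crux `ArrangementNormalForm`, line `janus-bands`, v6) — part `Janus`

Janus extensions (rule 1a with a NON-restriction piece) on the literal class text `GG b σ K`,
any base dimension: `RebasePos.janusCore` (`[T] − [D] − [W] ∈ KZ.relations` for literal
`T ⊇ D, W` with `T ∖ (D ∪ W)` null, provided the literal integrand converges absolutely on the
wedge `W`), and the two standard instances `RebasePos.janusExtendLo` / `janusExtendHi`
(replace the affine lower / upper bound `θ` of one fibre by an affine level `κ` beyond it; the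
wedge is `{κ < tᵢ < θ}` resp. `{θ < tᵢ < κ}`, the level set `tᵢ = θ` is null). The absolute
convergence of the wedge is the caller's obligation: it is the analytic crux of every rebase
(it does NOT follow from that of `D` by domination when the letter approaches the apex along
the base, cf. the unit tests in the stub notes). Registered: `rebaseSimplePos_janusExtendLo`.

References: M. Kontsevich, D. Zagier, *Periods* (2001), §1.2, rule (1).
-/

noncomputable section

open Set MeasureTheory MvPolynomial
open Literature.NumberTheory.Transcendental Literature.ModelTheory.ExponentialFields

namespace Summit.KontsevichZagierPeriods.ArrangementNormalForm.JanusBands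

namespace RebasePos

open SeparatePos

section Janus

open IntegrateOutLow

variable {b K m m' : ℕ}

/-- Integrability on a null set (any dimension). -/
theorem integrableOn_of_null {n : ℕ} {f : (Fin n → ℝ) → ℝ} {N : Set (Fin n → ℝ)}
    (hN : volume N = 0) : IntegrableOn f N := by
  rw [IntegrableOn, Measure.restrict_eq_zero.2 hN]
  exact integrable_zero_measure

/-- The level set `{tᵢ = θ(x', y)}` of a fibre against an affine form is null. -/
theorem volume_fibre_eq_affF (i : Fin K) (θ : (Fin (b + 1) → ℚ) × ℚ) :
    volume {z : Fin (b + 1 + K) → ℝ | z (Fin.natAdd (b + 1) i) = affF b K θ z} = 0 := by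
  have h := volume_setOf_aeval_eq (X (Fin.natAdd (b + 1) i) : MvPolynomial (Fin (b + 1 + K)) ℚ)
    (affFPoly (K := K) θ) (fun l => if l = Fin.natAdd (b + 1) i then (θ.2 : ℝ) + 1 else 0) (by
      rw [aeval_affFPoly]
      simp [affF, castAdd_ne_natAdd])
  convert h using 2 with z
  simp only [aeval_X, aeval_affFPoly]

/-- **Janus extension, core** (rule 1a with a non-restriction piece, any dimension). Let `s` have
a literal domain `D` and the literal integrand `f = glit …` on it. If `T ⊇ D, W` are literal
domains with `T ∖ (D ∪ W)` null, `D ∩ W = ∅`, `T` bounded, and `f` is absolutely integrable on the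
WEDGE `W`, then `T` and `W` carry literal representations `sT`, `sW` (integrand `f`) with
`[sT] − [s] − [sW] ∈ KZ.relations`. -/
theorem janusCore (s : KZ.IntegralRep (b + 1 + K)) {mT mW : ℕ}
    (MT : Fin mT → (Fin (b + 1) → ℚ) × ℚ) (loT hiT : Fin K → Fin K ⊕ ((Fin (b + 1) → ℚ) × ℚ))
    (MW : Fin mW → (Fin (b + 1) → ℚ) × ℚ) (loW hiW : Fin K → Fin K ⊕ ((Fin (b + 1) → ℚ) × ℚ))
    (L : Fin m → (Fin b → ℚ) × ℚ) (e : Fin m → ℕ) (p : MvPolynomial (Fin b) ℚ)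
    (ℓ₁ ℓ₂ : (Fin b → ℚ) × ℚ) (n₁ n₂ : ℕ) (a : Fin K → Option ((Fin (b + 1) → ℚ) × ℚ))
    (hint : EqOn s.integrand (glit b K p L e ℓ₁ ℓ₂ n₁ n₂ a) s.domain)
    (hW : IntegrableOn (glit b K p L e ℓ₁ ℓ₂ n₁ n₂ a) (gDom b K mW MW loW hiW))
    {N : Set (Fin (b + 1 + K) → ℝ)} (hN : volume N = 0)
    (hTsub : gDom b K mT MT loT hiT ⊆ s.domain ∪ gDom b K mW MW loW hiW ∪ N)
    (hDT : s.domain ⊆ gDom b K mT MT loT hiT)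
    (hWT : gDom b K mW MW loW hiW ⊆ gDom b K mT MT loT hiT)
    (hDW : Disjoint s.domain (gDom b K mW MW loW hiW))
    (hbd : Bornology.IsBounded (gDom b K mT MT loT hiT)) :
    ∃ sT sW : KZ.IntegralRep (b + 1 + K),
      sT.domain = gDom b K mT MT loT hiT ∧ sT.integrand = glit b K p L e ℓ₁ ℓ₂ n₁ n₂ a ∧
      Bornology.IsBounded sT.domain ∧
      sW.domain = gDom b K mW MW loW hiW ∧ sW.integrand = glit b K p L e ℓ₁ ℓ₂ n₁ n₂ a ∧
      Bornology.IsBounded sW.domain ∧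
      KZ.of sT - KZ.of s - KZ.of sW ∈ KZ.relations := by
  set f := glit b K p L e ℓ₁ ℓ₂ n₁ n₂ a with hf
  set T := gDom b K mT MT loT hiT with hT
  set W := gDom b K mW MW loW hiW with hWdef
  have hDm : MeasurableSet s.domain := KZ.IntegralRep.measurableSet_domain_holds s
  have hfD : IntegrableOn f s.domain := s.integrableOn.congr_fun hint hDm
  have hfT : IntegrableOn f T := ((hfD.union hW).union (integrableOn_of_null hN)).mono_set hTsub
  set sW : KZ.IntegralRep (b + 1 + K) := ⟨W, f, isSemialgebraic_gDom _ _ _ _,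
    isSemialgebraicFunOn_glit (isSemialgebraic_gDom _ _ _ _) _ _ _ _ _ _ _ _, hW⟩ with hsW
  set sT : KZ.IntegralRep (b + 1 + K) := ⟨T, f, isSemialgebraic_gDom _ _ _ _,
    isSemialgebraicFunOn_glit (isSemialgebraic_gDom _ _ _ _) _ _ _ _ _ _ _ _, hfT⟩ with hsT
  refine ⟨sT, sW, rfl, rfl, hbd, rfl, rfl, hbd.subset hWT, ?_⟩
  set R : Fin 2 → KZ.IntegralRep (b + 1 + K) := ![s, sW] with hR
  have hR0 : R 0 = s := rfl
  have hR1 : R 1 = sW := rfl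
  have hrel : KZ.of sT - ∑ i, KZ.of (R i) ∈ KZ.relations := by
    refine KZ.of_sub_sum_of_mem_relations Finset.univ sT R ?_ ?_ ?_ ?_
    · refine Fin.forall_fin_two.2 ⟨fun _ => ?_, fun _ => ?_⟩
      · rw [hR0, Set.sdiff_eq_empty.2 hDT, measure_empty]
      · rw [hR1, Set.sdiff_eq_empty.2 hWT, measure_empty]
    · refine Fin.forall_fin_two.2 ⟨fun _ z hz => ?_, fun _ _ _ => rfl⟩
      rw [hR0] at hz
      exact hint hz.1
    · refine measure_mono_null (fun z hz => ?_) hN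
      have hz' : z ∉ s.domain ∪ W := fun hz' => hz.2 <| by
        rcases hz' with hz' | hz'
        · exact mem_iUnion₂.2 ⟨0, Finset.mem_univ _, hz'⟩
        · exact mem_iUnion₂.2 ⟨1, Finset.mem_univ _, hz'⟩
      rcases hTsub hz.1 with hz1 | hz1
      · exact absurd hz1 hz'
      · exact hz1
    · intro i _ j _ hij
      have key : ∀ i j : Fin 2, i ≠ j → (R i).domain ∩ (R j).domain = ∅ := by
        refine Fin.forall_fin_two.2 ⟨Fin.forall_fin_two.2 ⟨fun h => absurd rfl h, fun _ => ?_⟩,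
          Fin.forall_fin_two.2 ⟨fun _ => ?_, fun h => absurd rfl h⟩⟩
        · rw [hR0, hR1]; exact hDW.inter_eq
        · rw [hR0, hR1, inter_comm]; exact hDW.inter_eq
      rw [key i j hij, measure_empty]
  rw [Fin.sum_univ_two, hR0, hR1] at hrel
  simpa [sub_sub] using hrel

/-- **Janus extension of a lower bound.** Replace the affine lower bound `θ` of the fibre `i` by
a lower affine level `κ ≤ θ` (on the base cell): `T = {κ < tᵢ < hiᵢ}` is `D = {θ < tᵢ < hiᵢ}`
plus the wedge `W = {κ < tᵢ < θ}` (the level set `tᵢ = θ` is null), provided `θ ≤ hiᵢ` on `W`.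
If the literal integrand is absolutely integrable on `W` and `T` is bounded,
`[sT] − [s] − [sW] ∈ KZ.relations`. -/
theorem janusExtendLo (s : KZ.IntegralRep (b + 1 + K)) (M : Fin m' → (Fin (b + 1) → ℚ) × ℚ)
    (lo hi : Fin K → Fin K ⊕ ((Fin (b + 1) → ℚ) × ℚ)) (hdom : s.domain = gDom b K m' M lo hi)
    (L : Fin m → (Fin b → ℚ) × ℚ) (e : Fin m → ℕ) (p : MvPolynomial (Fin b) ℚ)
    (ℓ₁ ℓ₂ : (Fin b → ℚ) × ℚ) (n₁ n₂ : ℕ) (a : Fin K → Option ((Fin (b + 1) → ℚ) × ℚ))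
    (hint : EqOn s.integrand (glit b K p L e ℓ₁ ℓ₂ n₁ n₂ a) s.domain)
    (i : Fin K) (θ κ : (Fin (b + 1) → ℚ) × ℚ) (hlo : lo i = Sum.inr θ)
    (hle : ∀ z : Fin (b + 1 + K) → ℝ, (∀ j, 0 < affF b K (M j) z) → affF b K κ z ≤ affF b K θ z)
    (hθ : ∀ z ∈ gDom b K m' M (Function.update lo i (Sum.inr κ)) (Function.update hi i (Sum.inr θ)),
      affF b K θ z ≤ pv (hi i) z)
    (hW : IntegrableOn (glit b K p L e ℓ₁ ℓ₂ n₁ n₂ a)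
      (gDom b K m' M (Function.update lo i (Sum.inr κ)) (Function.update hi i (Sum.inr θ))))
    (hbd : Bornology.IsBounded (gDom b K m' M (Function.update lo i (Sum.inr κ)) hi)) :
    ∃ sT sW : KZ.IntegralRep (b + 1 + K),
      sT.domain = gDom b K m' M (Function.update lo i (Sum.inr κ)) hi ∧
      sT.integrand = glit b K p L e ℓ₁ ℓ₂ n₁ n₂ a ∧ Bornology.IsBounded sT.domain ∧
      sW.domain = gDom b K m' M (Function.update lo i (Sum.inr κ)) (Function.update hi i (Sum.inr θ)) ∧
      sW.integrand = glit b K p L e ℓ₁ ℓ₂ n₁ n₂ a ∧ Bornology.IsBounded sW.domain ∧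
      KZ.of sT - KZ.of s - KZ.of sW ∈ KZ.relations := by
  -- membership in the three literal domains, fibre `i` separated from the others
  have key : ∀ (g g' : Fin K → Fin K ⊕ ((Fin (b + 1) → ℚ) × ℚ)) (z : Fin (b + 1 + K) → ℝ),
      z ∈ gDom b K m' M g g' ↔ (∀ j, 0 < affF b K (M j) z) ∧
        (pv (g i) z < z (Fin.natAdd (b + 1) i) ∧ z (Fin.natAdd (b + 1) i) < pv (g' i) z) ∧
        ∀ i', i' ≠ i → pv (g i') z < z (Fin.natAdd (b + 1) i') ∧
          z (Fin.natAdd (b + 1) i') < pv (g' i') z := by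
    intro g g' z
    simp only [gDom, mem_setOf_eq, affF, pv]
    refine and_congr_right fun _ => ⟨fun h => ⟨h i, fun i' _ => h i'⟩, fun h i' => ?_⟩
    by_cases hi' : i' = i
    · rw [hi']; exact h.1
    · exact h.2 i' hi'
  have hupd : ∀ (g : Fin K → Fin K ⊕ ((Fin (b + 1) → ℚ) × ℚ)) (c : (Fin (b + 1) → ℚ) × ℚ)
      (z : Fin (b + 1 + K) → ℝ), pv (Function.update g i (Sum.inr c) i) z = affF b K c z := by
    intro g c z
    simp [pv, affF]
  have hupd' : ∀ (g : Fin K → Fin K ⊕ ((Fin (b + 1) → ℚ) × ℚ)) (c : (Fin (b + 1) → ℚ) × ℚ)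
      (z : Fin (b + 1 + K) → ℝ) (i' : Fin K), i' ≠ i →
      pv (Function.update g i (Sum.inr c) i') z = pv (g i') z := by
    intro g c z i' h
    rw [Function.update_of_ne h]
  have hloi : ∀ z, pv (lo i) z = affF b K θ z := fun z => by rw [hlo]; rfl
  refine janusCore s M _ _ M _ _ L e p ℓ₁ ℓ₂ n₁ n₂ a hint hW (volume_fibre_eq_affF i θ)
    ?_ ?_ ?_ ?_ hbd
  · intro z hz
    rw [key] at hz
    obtain ⟨hrow, ⟨h1, h2⟩, hrest⟩ := hz
    rw [hupd] at h1
    rcases lt_trichotomy (z (Fin.natAdd (b + 1) i)) (affF b K θ z) with ht | ht | ht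
    · refine Or.inl (Or.inr ?_)
      rw [key]
      refine ⟨hrow, ⟨by rwa [hupd], by rwa [hupd]⟩, fun i' hi' => ?_⟩
      simpa only [hupd' _ _ _ _ hi'] using hrest i' hi'
    · exact Or.inr ht
    · refine Or.inl (Or.inl ?_)
      rw [hdom, key]
      refine ⟨hrow, ⟨by rwa [hloi], h2⟩, fun i' hi' => ?_⟩
      simpa only [hupd' _ _ _ _ hi'] using hrest i' hi'
  · intro z hz
    rw [hdom, key] at hz
    obtain ⟨hrow, ⟨h1, h2⟩, hrest⟩ := hz
    rw [hloi] at h1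
    rw [key]
    refine ⟨hrow, ⟨?_, h2⟩, fun i' hi' => ?_⟩
    · rw [hupd]
      exact lt_of_le_of_lt (hle z hrow) h1
    · simpa only [hupd' _ _ _ _ hi'] using hrest i' hi'
  · intro z hz
    have hθz := hθ z hz
    rw [key] at hz
    obtain ⟨hrow, ⟨h1, h2⟩, hrest⟩ := hz
    rw [hupd] at h2
    rw [key]
    refine ⟨hrow, ⟨h1, lt_of_lt_of_le h2 hθz⟩, fun i' hi' => ?_⟩
    simpa only [hupd' _ _ _ _ hi'] using hrest i' hi'
  · rw [hdom]
    refine Set.disjoint_left.2 fun z hz hz' => ?_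
    rw [key] at hz hz'
    have h1 := hz.2.1.1
    have h2 := hz'.2.1.2
    rw [hloi] at h1
    rw [hupd] at h2
    exact lt_asymm h1 h2

/-- **Janus extension of an upper bound.** Replace the affine upper bound `θ` of the fibre `i` by
a higher affine level `κ ≥ θ` (on the base cell): `T = {loᵢ < tᵢ < κ}` is `D = {loᵢ < tᵢ < θ}`
plus the wedge `W = {θ < tᵢ < κ}`, provided `loᵢ ≤ θ` on `W`. -/
theorem janusExtendHi (s : KZ.IntegralRep (b + 1 + K)) (M : Fin m' → (Fin (b + 1) → ℚ) × ℚ)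
    (lo hi : Fin K → Fin K ⊕ ((Fin (b + 1) → ℚ) × ℚ)) (hdom : s.domain = gDom b K m' M lo hi)
    (L : Fin m → (Fin b → ℚ) × ℚ) (e : Fin m → ℕ) (p : MvPolynomial (Fin b) ℚ)
    (ℓ₁ ℓ₂ : (Fin b → ℚ) × ℚ) (n₁ n₂ : ℕ) (a : Fin K → Option ((Fin (b + 1) → ℚ) × ℚ))
    (hint : EqOn s.integrand (glit b K p L e ℓ₁ ℓ₂ n₁ n₂ a) s.domain)
    (i : Fin K) (θ κ : (Fin (b + 1) → ℚ) × ℚ) (hhi : hi i = Sum.inr θ)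
    (hle : ∀ z : Fin (b + 1 + K) → ℝ, (∀ j, 0 < affF b K (M j) z) → affF b K θ z ≤ affF b K κ z)
    (hθ : ∀ z ∈ gDom b K m' M (Function.update lo i (Sum.inr θ)) (Function.update hi i (Sum.inr κ)),
      pv (lo i) z ≤ affF b K θ z)
    (hW : IntegrableOn (glit b K p L e ℓ₁ ℓ₂ n₁ n₂ a)
      (gDom b K m' M (Function.update lo i (Sum.inr θ)) (Function.update hi i (Sum.inr κ))))
    (hbd : Bornology.IsBounded (gDom b K m' M lo (Function.update hi i (Sum.inr κ)))) :
    ∃ sT sW : KZ.IntegralRep (b + 1 + K),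
      sT.domain = gDom b K m' M lo (Function.update hi i (Sum.inr κ)) ∧
      sT.integrand = glit b K p L e ℓ₁ ℓ₂ n₁ n₂ a ∧ Bornology.IsBounded sT.domain ∧
      sW.domain = gDom b K m' M (Function.update lo i (Sum.inr θ)) (Function.update hi i (Sum.inr κ)) ∧
      sW.integrand = glit b K p L e ℓ₁ ℓ₂ n₁ n₂ a ∧ Bornology.IsBounded sW.domain ∧
      KZ.of sT - KZ.of s - KZ.of sW ∈ KZ.relations := by
  have key : ∀ (g g' : Fin K → Fin K ⊕ ((Fin (b + 1) → ℚ) × ℚ)) (z : Fin (b + 1 + K) → ℝ),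
      z ∈ gDom b K m' M g g' ↔ (∀ j, 0 < affF b K (M j) z) ∧
        (pv (g i) z < z (Fin.natAdd (b + 1) i) ∧ z (Fin.natAdd (b + 1) i) < pv (g' i) z) ∧
        ∀ i', i' ≠ i → pv (g i') z < z (Fin.natAdd (b + 1) i') ∧
          z (Fin.natAdd (b + 1) i') < pv (g' i') z := by
    intro g g' z
    simp only [gDom, mem_setOf_eq, affF, pv]
    refine and_congr_right fun _ => ⟨fun h => ⟨h i, fun i' _ => h i'⟩, fun h i' => ?_⟩
    by_cases hi' : i' = i
    · rw [hi']; exact h.1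
    · exact h.2 i' hi'
  have hupd : ∀ (g : Fin K → Fin K ⊕ ((Fin (b + 1) → ℚ) × ℚ)) (c : (Fin (b + 1) → ℚ) × ℚ)
      (z : Fin (b + 1 + K) → ℝ), pv (Function.update g i (Sum.inr c) i) z = affF b K c z := by
    intro g c z
    simp [pv, affF]
  have hupd' : ∀ (g : Fin K → Fin K ⊕ ((Fin (b + 1) → ℚ) × ℚ)) (c : (Fin (b + 1) → ℚ) × ℚ)
      (z : Fin (b + 1 + K) → ℝ) (i' : Fin K), i' ≠ i →
      pv (Function.update g i (Sum.inr c) i') z = pv (g i') z := by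
    intro g c z i' h
    rw [Function.update_of_ne h]
  have hhii : ∀ z, pv (hi i) z = affF b K θ z := fun z => by rw [hhi]; rfl
  refine janusCore s M _ _ M _ _ L e p ℓ₁ ℓ₂ n₁ n₂ a hint hW (volume_fibre_eq_affF i θ)
    ?_ ?_ ?_ ?_ hbd
  · intro z hz
    rw [key] at hz
    obtain ⟨hrow, ⟨h1, h2⟩, hrest⟩ := hz
    rw [hupd] at h2
    rcases lt_trichotomy (z (Fin.natAdd (b + 1) i)) (affF b K θ z) with ht | ht | ht
    · refine Or.inl (Or.inl ?_)
      rw [hdom, key]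
      refine ⟨hrow, ⟨h1, by rwa [hhii]⟩, fun i' hi' => ?_⟩
      simpa only [hupd' _ _ _ _ hi'] using hrest i' hi'
    · exact Or.inr ht
    · refine Or.inl (Or.inr ?_)
      rw [key]
      refine ⟨hrow, ⟨by rwa [hupd], by rwa [hupd]⟩, fun i' hi' => ?_⟩
      simpa only [hupd' _ _ _ _ hi'] using hrest i' hi'
  · intro z hz
    rw [hdom, key] at hz
    obtain ⟨hrow, ⟨h1, h2⟩, hrest⟩ := hz
    rw [hhii] at h2
    rw [key]
    refine ⟨hrow, ⟨h1, ?_⟩, fun i' hi' => ?_⟩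
    · rw [hupd]
      exact lt_of_lt_of_le h2 (hle z hrow)
    · simpa only [hupd' _ _ _ _ hi'] using hrest i' hi'
  · intro z hz
    have hθz := hθ z hz
    rw [key] at hz
    obtain ⟨hrow, ⟨h1, h2⟩, hrest⟩ := hz
    rw [hupd] at h1
    rw [key]
    refine ⟨hrow, ⟨lt_of_le_of_lt hθz h1, h2⟩, fun i' hi' => ?_⟩
    simpa only [hupd' _ _ _ _ hi'] using hrest i' hi'
  · rw [hdom]
    refine Set.disjoint_left.2 fun z hz hz' => ?_
    rw [key] at hz hz'
    have h1 := hz.2.1.2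
    have h2 := hz'.2.1.1
    rw [hhii] at h1
    rw [hupd] at h2
    exact lt_asymm h1 h2

end Janus

end RebasePos

/-- Registered support goal of this file: Janus extension of a lower bound
(`RebasePos.janusExtendLo`). -/
theorem rebaseSimplePos_janusExtendLo (b K m m' : ℕ) (s : KZ.IntegralRep (b + 1 + K)) (M : Fin m' → (Fin (b + 1) → ℚ) × ℚ) (lo hi : Fin K → Fin K ⊕ ((Fin (b + 1) → ℚ) × ℚ)) (hdom : s.domain = SeparatePos.gDom b K m' M lo hi) (L : Fin m → (Fin b → ℚ) × ℚ) (e : Fin m → ℕ) (p : MvPolynomial (Fin b) ℚ) (ℓ₁ ℓ₂ : (Fin b → ℚ) × ℚ) (n₁ n₂ : ℕ) (a : Fin K → Option ((Fin (b + 1) → ℚ) × ℚ)) (hint : EqOn s.integrand (RebasePos.glit b K p L e ℓ₁ ℓ₂ n₁ n₂ a) s.domain) (i : Fin K) (θ κ : (Fin (b + 1) → ℚ) × ℚ) (hlo : lo i = Sum.inr θ) (hle : ∀ z : Fin (b + 1 + K) → ℝ, (∀ j, 0 < SeparatePos.affF b K (M j) z) → SeparatePos.affF b K κ z ≤ SeparatePos.affF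 b K θ z) (hθ : ∀ z ∈ SeparatePos.gDom b K m' M (Function.update lo i (Sum.inr κ)) (Function.update hi i (Sum.inr θ)), SeparatePos.affF b K θ z ≤ RebasePos.pv (hi i) z) (hW : IntegrableOn (RebasePos.glit b K p L e ℓ₁ ℓ₂ n₁ n₂ a) (SeparatePos.gDom b K m' M (Function.update lo i (Sum.inr κ)) (Function.update hi i (Sum.inr θ)))) (hbd : Bornology.IsBounded (SeparatePos.gDom b K m' M (Function.update lo i (Sum.inr κ)) hi)) : ∃ sT sW : KZ.IntegralRep (b + 1 + K), sT.domain = SeparatePos.gDom b K m' M (Function.update lo i (Sum.inr κ)) hi ∧ sT.integrand = RebasePos.glit b K p L e ℓ₁ ℓ₂ n₁ n₂ a ∧ Bornology.IsBounded sT.domain ∧ sW.domain = SeparatePos.gDom b K m' M (Function.update lo i (Sum.inr κ)) (Function.update hi i (Sum.inr θ)) ∧ sW.integrand = RebasePos.glit b K p L e ℓ₁ ℓ₂ n₁ n₂ a ∧ Bornology.IsBounded sW.domain ∧ KZ.of sT - KZ.of s - KZ.of sW ∈ KZ.relations :=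
  RebasePos.janusExtendLo s M lo hi hdom L e p ℓ₁ ℓ₂ n₁ n₂ a hint i θ κ hlo hle hθ hW hbd

end Summit.KontsevichZagierPeriods.ArrangementNormalForm.JanusBands
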